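import Literature.MathematicalPhysics.QuantumFieldTheory.Balaban1983to89.B9Eq340TaxiLasso

/-!
# `Balaban1983to89.B9Eq340TaxiRungs` — T. Bałaban, *Propagators for lattice gauge theories in a background field*, Commun. Math. Phys. **99** (1985) 389–434
# [Balaban1985BackgroundPropagators], (3.40) p. 397 with (3.1) p. 390: WHERE THE RUNGS OF A TAXICAB LADDER LIE — every plaquette swept by the later legs has its
# corners coordinatewise ON THE SHORTER ARC between the start and the target, hence inside any coordinate box (side `≤` half the period) containing both
# (the localisation step between `B9Eq340TaxiLasso` and the cube class of (3.35))

statement-level skeleton of published theorems with citation tags; proofs where landed; nothing here is a claim about the Yang–Mills mass gap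

THE PRINT.  (3.40) p. 397 (shortest contours); (3.1) p. 390 (the periodic lattice `T_η`); (3.35) p. 396 (cubes of the class).

WHY THIS FILE (dag-n06-i gen 14, N06 bundle F4, row 26).  `B9Eq340TaxiLasso.norm_taxiLasso_sub_one_le` bounds a taxicab lasso by `stepDefect κ U ρ y`, the sum of the
defects of the plaquettes met by the later legs `ρ`; `B9Eq340StepLasso.stepDefect_le_of_forall` turns a uniform bound on those plaquettes into `|ρ|·δ`.  To get the uniform
bound from (3.35) one must know the met plaquettes lie in a class cube: THIS FILE proves that every met site (`rungSites ρ y`) and its step-successor have every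
coordinate on the shorter arc from the start coordinate to the target coordinate (`OnArc`), that the shorter arc between two points of a coordinate interval of
length `≤ period∕2` stays in the interval (`onArc_mem_interval`), and counts the steps (`length_taxiSteps_le`).

WHAT IS PROVED (sorry-free; def `OnArc`).
* §1 `OnArc c t u`, `onArc_left`, `onArc_right`, ★ `onArc_mem_interval`.
* §2 `rungSites_append`, `rungSites_replicate_true ∕ _false`, ★ `rungSites_legSteps` (one leg), ★★ `rungSites_taxiSteps` (all later legs: the met site
  and its successor are coordinatewise on the arcs, and agree with the start off the listed directions), `length_legSteps_le`, `length_taxiSteps_le`.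

HONEST SCOPE.  Lattice bookkeeping; nothing of [B9] asserted; count-neutral; N06 NOT discharged.  Cell `pub-ymgap` (HUMAN RULING D-0062), Track A node N06 [B9], seat
`pub-ymgap-dag-n06-i` (gen 14), 2026-08-27; a NEW file.
-/

namespace Literature.MathematicalPhysics.QuantumFieldTheory.Balaban1983to89.B9Eq340TaxiRungs

open Finset
open B9BackgroundsKLevelV1 (CfgV1 shiftsV1)
open Node00 (iterate_shift_apply iterate_unshift_apply)
open B9Eq340StepLasso (stepRun stepEnd legSteps taxiSteps rungSites stepEnd_append stepEnd_replicate_true stepEnd_replicate_false taxiSteps_congr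
  stepEnd_legSteps_apply_of_ne length_rungSites)
open B9Eq340TaxiLasso (val_add_one_of_lt val_sub_add_val_sub)
open B10StarCount (shift_unshift unshift_shift)

variable {P : Params}

/-! ## §1 The shorter arc between two coordinates -/

section Arc

variable {n : ℕ} [NeZero n]

/-- `u` lies ON THE SHORTER ARC from `c` to `t` (the way def-Y's `taxiLegV` runs): forward within `(t−c).val` steps, or backward within `(c−t).val` steps.
[cite: Balaban1985BackgroundPropagators, (3.40) p.397 («a shortest contour»), bookkeeping] -/
def OnArc (c t u : ZMod n) : Prop := if (t - c).val ≤ (c - t).val then (u - c).val ≤ (t - c).val else (c - u).val ≤ (c - t).val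

omit [NeZero n] in
/-- the start is on the arc. [cite: Balaban1985BackgroundPropagators, (3.40) p.397, bookkeeping] -/
theorem onArc_left (c t : ZMod n) : OnArc c t c := by
  unfold OnArc; split_ifs <;> simp

omit [NeZero n] in
/-- the target is on the arc. [cite: Balaban1985BackgroundPropagators, (3.40) p.397, bookkeeping] -/
theorem onArc_right (c t : ZMod n) : OnArc c t t := by
  unfold OnArc; split_ifs with h
  · exact le_rfl
  · exact le_rfl

/-- `(a + b).val = a.val + b.val` or `= a.val + b.val − n`. [cite: Balaban1985BackgroundPropagators, (3.1) p.390, bookkeeping] -/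
theorem val_add_cases (a b : ZMod n) : ((a + b).val = a.val + b.val ∧ a.val + b.val < n) ∨ ((a + b).val + n = a.val + b.val ∧ n ≤ a.val + b.val) := by
  rcases Nat.lt_or_ge (a.val + b.val) n with h | h
  · exact Or.inl ⟨ZMod.val_add_of_lt h, h⟩
  · exact Or.inr ⟨(ZMod.val_add_val_of_le h).symm, h⟩

/-- ★ **THE SHORTER ARC STAYS IN A SHORT INTERVAL**: if `c` and `t` lie in the coordinate interval `{u | (u − c₀).val < s}` with `2s ≤ n`, so does every point of the
shorter arc from `c` to `t` (the other way round is longer than `n∕2`). [cite: Balaban1985BackgroundPropagators, (3.40) p.397, (3.1) p.390, bookkeeping] -/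
theorem onArc_mem_interval {c₀ c t u : ZMod n} {s : ℕ} (hs : 2 * s ≤ n) (hc : (c - c₀).val < s) (ht : (t - c₀).val < s) (hu : OnArc c t u) :
    (u - c₀).val < s := by
  unfold OnArc at hu
  by_cases hct : t = c
  · subst hct
    simp only [sub_self, ZMod.val_zero, le_refl, if_true, Nat.le_zero] at hu
    have : u = t := by rwa [ZMod.val_eq_zero, sub_eq_zero] at hu
    rw [this]; exact ht
  have hsum := val_sub_add_val_sub hct
  split_ifs at hu with hreg
  · -- forward: `u = c + m`, `m ≤ a ≤ n/2`
    have key := val_add_cases (u - c) (c - c₀)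
    have e1 : u - c + (c - c₀) = u - c₀ := by ring
    rw [e1] at key
    have keyt := val_add_cases (t - c) (c - c₀)
    have e2 : t - c + (c - c₀) = t - c₀ := by ring
    rw [e2] at keyt
    rcases keyt with ⟨ht1, ht2⟩ | ⟨ht1, ht2⟩
    · rcases key with ⟨hu1, hu2⟩ | ⟨hu1, hu2⟩ <;> omega
    · omega
  · -- backward: `u = c − m`, `m ≤ b < n/2`
    rw [not_le] at hreg
    have key := val_add_cases (c - u) (u - c₀)
    have e1 : c - u + (u - c₀) = c - c₀ := by ring
    rw [e1] at key
    have keyt := val_add_cases (c - t) (t - c₀)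
    have e2 : c - t + (t - c₀) = c - c₀ := by ring
    rw [e2] at keyt
    have hu' := ZMod.val_lt (u - c₀)
    rcases keyt with ⟨ht1, ht2⟩ | ⟨ht1, ht2⟩
    · rcases key with ⟨hu1, hu2⟩ | ⟨hu1, hu2⟩ <;> omega
    · omega

end Arc

/-! ## §2 Where the rungs of the later legs lie -/

variable {𝔸 : Type} [NormedRing 𝔸]

/-- rung sites concatenate. [cite: Balaban1985BackgroundPropagators, (3.40) p.397, bookkeeping] -/
theorem rungSites_append : ∀ (l₁ l₂ : List (Fin P.d × Bool)) (w : Site P 0), rungSites (l₁ ++ l₂) w = rungSites l₁ w ++ rungSites l₂ (stepEnd l₁ w)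
  | [], _, _ => by simp [rungSites, stepEnd]
  | (ν, true) :: l, l₂, w => by rw [List.cons_append]; simp only [rungSites, stepEnd]; rw [rungSites_append l l₂, List.cons_append]
  | (ν, false) :: l, l₂, w => by rw [List.cons_append]; simp only [rungSites, stepEnd]; rw [rungSites_append l l₂, List.cons_append]

/-- the rungs of a forward straight leg. [cite: Balaban1985BackgroundPropagators, (3.40) p.397, bookkeeping] -/
theorem rungSites_replicate_true (ν : Fin P.d) : ∀ (k : ℕ) (w : Site P 0),
    ∀ r ∈ rungSites (List.replicate k (ν, true)) w, ∃ m, m < k ∧ r = ((fun y : Site P 0 => y.shift ν)^[m] w, ν, true)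
  | 0, _, r, hr => by simp [rungSites] at hr
  | k + 1, w, r, hr => by
    rw [List.replicate_succ] at hr
    simp only [rungSites, List.mem_cons] at hr
    rcases hr with hr | hr
    · exact ⟨0, by omega, by rw [hr]; rfl⟩
    · obtain ⟨m, hm, e⟩ := rungSites_replicate_true ν k _ r hr
      exact ⟨m + 1, by omega, by rw [e, Function.iterate_succ_apply]⟩

/-- the rungs of a backward straight leg. [cite: Balaban1985BackgroundPropagators, (3.40) p.397, bookkeeping] -/
theorem rungSites_replicate_false (ν : Fin P.d) : ∀ (k : ℕ) (w : Site P 0),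
    ∀ r ∈ rungSites (List.replicate k (ν, false)) w, ∃ m, m < k ∧ r = ((fun y : Site P 0 => y.unshift ν)^[m + 1] w, ν, false)
  | 0, _, r, hr => by simp [rungSites] at hr
  | k + 1, w, r, hr => by
    rw [List.replicate_succ] at hr
    simp only [rungSites, List.mem_cons] at hr
    rcases hr with hr | hr
    · exact ⟨0, by omega, by rw [hr]; rfl⟩
    · obtain ⟨m, hm, e⟩ := rungSites_replicate_false ν k _ r hr
      exact ⟨m + 1, by omega, by rw [e, ← Function.iterate_succ_apply]⟩

/-- ★ **ONE LEG**: every rung site `v` of the `ν`-leg from `w` (with `w_ν = c`) towards the coordinate `t`, and its successor `v + e_ν`, have `ν`-coordinate on the shorter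
arc from `c` to `t` and the other coordinates those of `w`; the step direction is `ν`. [cite: Balaban1985BackgroundPropagators, (3.40) p.397] -/
theorem rungSites_legSteps (ν : Fin P.d) {c t : ZMod (P.sitesPerDir 0)} {w : Site P 0} (hw : w ν = c) :
    ∀ r ∈ rungSites (legSteps ν c t) w,
      r.2.1 = ν ∧ (∀ μ, μ ≠ ν → r.1 μ = w μ) ∧ OnArc c t (r.1 ν) ∧ OnArc c t ((r.1.shift ν) ν) := by
  intro r hr
  have hNp := P.one_lt_sitesPerDir 0
  unfold legSteps at hr
  unfold OnArc
  split_ifs at hr with hreg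
  · obtain ⟨m, hm, e⟩ := rungSites_replicate_true ν _ w r hr
    have ha := ZMod.val_lt (t - c)
    subst e
    refine ⟨rfl, fun μ hμ => by simp only [iterate_shift_apply, if_neg hμ], ?_, ?_⟩
    · dsimp only
      rw [if_pos hreg, iterate_shift_apply, if_pos rfl, hw, add_sub_cancel_left, ZMod.val_cast_of_lt (by omega)]; omega
    · dsimp only
      rw [if_pos hreg, ← Function.iterate_succ_apply' (f := fun y : Site P 0 => y.shift ν), iterate_shift_apply, if_pos rfl, hw, add_sub_cancel_left,
        ZMod.val_cast_of_lt (by omega)]; omega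
  · obtain ⟨m, hm, e⟩ := rungSites_replicate_false ν _ w r hr
    have hb := ZMod.val_lt (c - t)
    subst e
    refine ⟨rfl, fun μ hμ => by simp only [iterate_unshift_apply, if_neg hμ], ?_, ?_⟩
    · dsimp only
      rw [if_neg hreg, iterate_unshift_apply, if_pos rfl, hw, sub_sub_cancel, ZMod.val_cast_of_lt (by omega)]; omega
    · dsimp only
      rw [if_neg hreg, Function.iterate_succ_apply', shift_unshift, iterate_unshift_apply, if_pos rfl, hw, sub_sub_cancel, ZMod.val_cast_of_lt (by omega)]; omega

/-- a leg reaches its target coordinate. [cite: Balaban1985BackgroundPropagators, (3.40) p.397, bookkeeping] -/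
theorem stepEnd_legSteps_apply_self (ν : Fin P.d) {c t : ZMod (P.sitesPerDir 0)} {w : Site P 0} (hw : w ν = c) : stepEnd (legSteps ν c t) w ν = t := by
  have h := Node00.taxiLegV_fst_apply (fun _ _ => (1 : (ℤ)ˣ)) (Function.update w ν t) (w, 1) ν ν
  rw [B9Eq340StepLasso.taxiLegV_eq_stepRun, if_pos rfl, Function.update_self] at h
  simpa [hw] using h

/-- ★★ **ALL LATER LEGS**: for distinct directions `l`, every rung site `v` of `taxiSteps l p z` from `p`, and its successor `v + e_{step}`, satisfy: the step direction is in
`l`; coordinates off `l` are those of `p`; every coordinate `μ ∈ l` is on the shorter arc from `p_μ` to `z_μ`. [cite: Balaban1985BackgroundPropagators, (3.40) p.397] -/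
theorem rungSites_taxiSteps (z : Site P 0) :
    ∀ (l : List (Fin P.d)), l.Nodup → ∀ (p : Site P 0), ∀ r ∈ rungSites (taxiSteps l p z) p,
      r.2.1 ∈ l ∧ (∀ μ, μ ∉ l → r.1 μ = p μ ∧ (r.1.shift r.2.1) μ = p μ) ∧
        (∀ μ, μ ∈ l → OnArc (p μ) (z μ) (r.1 μ) ∧ OnArc (p μ) (z μ) ((r.1.shift r.2.1) μ))
  | [], _, p, r, hr => by simp [taxiSteps, rungSites] at hr
  | ν :: l, hnd, p, r, hr => by
    rw [List.nodup_cons] at hnd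
    simp only [taxiSteps] at hr
    rw [rungSites_append, List.mem_append] at hr
    set p' := stepEnd (legSteps ν (p ν) (z ν)) p with hp'
    have hp'μ : ∀ μ, μ ≠ ν → p' μ = p μ := fun μ hμ => stepEnd_legSteps_apply_of_ne ν _ _ p hμ
    have hp'ν : p' ν = z ν := stepEnd_legSteps_apply_self ν rfl
    rcases hr with hr | hr
    · -- a rung of the `ν`-leg
      obtain ⟨hdir, hoth, h1, h2⟩ := rungSites_legSteps ν (w := p) rfl r hr
      refine ⟨by simp [hdir], fun μ hμ => ?_, fun μ hμ => ?_⟩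
      · have hμν : μ ≠ ν := fun h => hμ (by simp [h])
        rw [hdir]
        exact ⟨hoth μ hμν, by rw [B6Ineq2142KLevelV1.shift_apply_of_ne _ hμν, hoth μ hμν]⟩
      · rw [hdir]
        rcases List.mem_cons.1 hμ with hμ | hμ
        · subst hμ; exact ⟨h1, h2⟩
        · have hμν : μ ≠ ν := fun h => hnd.1 (h ▸ hμ)
          rw [B6Ineq2142KLevelV1.shift_apply_of_ne _ hμν, hoth μ hμν]
          exact ⟨onArc_left _ _, onArc_left _ _⟩
    · -- a rung of the later legs, started from `p'`
      have hsame : taxiSteps l p z = taxiSteps l p' z := (taxiSteps_congr (fun μ hμ => hp'μ μ (fun h => hnd.1 (h ▸ hμ))) (fun _ _ => rfl)).symm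
      rw [hsame] at hr
      obtain ⟨hdir, hoff, hon⟩ := rungSites_taxiSteps z l hnd.2 p' r hr
      have hdν : r.2.1 ≠ ν := fun h => hnd.1 (h ▸ hdir)
      refine ⟨List.mem_cons_of_mem _ hdir, fun μ hμ => ?_, fun μ hμ => ?_⟩
      · have hμν : μ ≠ ν := fun h => hμ (by simp [h])
        have hμl : μ ∉ l := fun h => hμ (List.mem_cons_of_mem _ h)
        obtain ⟨e1, e2⟩ := hoff μ hμl
        exact ⟨e1.trans (hp'μ μ hμν), e2.trans (hp'μ μ hμν)⟩
      · rcases List.mem_cons.1 hμ with hμ | hμ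
        · subst hμ
          obtain ⟨e1, e2⟩ := hoff μ hnd.1
          rw [e1, e2, hp'ν]
          exact ⟨onArc_right _ _, onArc_right _ _⟩
        · have hμν : μ ≠ ν := fun h => hnd.1 (h ▸ hμ)
          have := hon μ hμ
          rwa [hp'μ μ hμν] at this

/-- one leg has at most `min((t−c).val, (c−t).val)`… precisely: its length is the shorter count. [cite: Balaban1985BackgroundPropagators, (3.40) p.397, bookkeeping] -/
theorem length_legSteps (ν : Fin P.d) (c t : ZMod (P.sitesPerDir 0)) :
    (legSteps ν c t).length = if (t - c).val ≤ (c - t).val then (t - c).val else (c - t).val := by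
  unfold legSteps; split_ifs <;> simp

/-- the later legs have at most `Σ_{ν∈l}` (shorter count in direction `ν`) steps; with a uniform bound `K` per direction, `≤ |l|·K`.
[cite: Balaban1985BackgroundPropagators, (3.40) p.397, bookkeeping] -/
theorem length_taxiSteps_le (p z : Site P 0) {K : ℕ} (hK : ∀ ν, min (z ν - p ν).val (p ν - z ν).val ≤ K) :
    ∀ l : List (Fin P.d), (taxiSteps l p z).length ≤ l.length * K
  | [] => by simp [taxiSteps]
  | ν :: l => by
    simp only [taxiSteps, List.length_append, List.length_cons, length_legSteps]
    have h := hK ν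
    have ih := length_taxiSteps_le p z hK l
    split_ifs with hle
    · rw [min_eq_left hle] at h; nlinarith
    · rw [min_eq_right (not_le.1 hle).le] at h; nlinarith

end Literature.MathematicalPhysics.QuantumFieldTheory.Balaban1983to89.B9Eq340TaxiRungs
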